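import Literature.AlgebraicGeometry.GroupSchemes.FiniteGroupSchemeKernelRank            -- ★ (KR) `finrank_alg_ker_mul_finrank`, `flat_left_of_comap_injective`, `surjective_left_of_comap_injective`
import Literature.AlgebraicGeometry.GroupSchemes.CartierDualBlockReduction              -- ★ `isMonHom_of_comp_mono`
import Literature.AlgebraicGeometry.AbelianSchemes.WeilUnitKernelIsotropicOfDescent     -- ★ `appTop_injective_of_epi` (functions descend along an epimorphism)
import HarnessLib

/-!
# fppf-LIFTABLE homomorphisms of finite group schemes over a field: `Γ` is injective, and THE RANK OF A PREIMAGE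
# `rk Γ(φ⁻¹N) · rk Γ(V) = rk Γ(W) · rk Γ(N)` ([Waterhouse1979] §14.1; [Tate1997FiniteFlatGroupSchemes] §(3.7)–(3.8); [MumfordAV1970] §12 Thm. 1)

Layer `Literature/AlgebraicGeometry/GroupSchemes`, namespace `Literature.AlgebraicGeometry.GroupSchemes.AffineGroupScheme` (continues ★ (KR)
`FiniteGroupSchemeKernelRank` — `Γ(f)` injective ⟺ `f` flat + surjective; `rk G₁ = rk Ker f · rk G₂` — and ★ `CartierDualAnnihilatorRank` §1).  THEOREMS ONLY
(no definition, no named fact, no instance, no notation, no `sorry`).  Cell `hodgecm-mathlib` (D-0151), P6 «MOD programme» (crux hLiu418 =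
stmt-HodgeConjecture-24832, `--supports`, count-neutral), half-A line L3 (socket `stub_ROOF0`, (rL-asm) `w`-block): the road-independent first organ of
the COMPLEMENTARY-RANK input **(I-rk)** «`rk Γ(W) = rk Γ(Ψ) · rk Γ(𝒦)`» of the (KW) socket (W-DOCK ED. 4 cand `WBlockLawED4c.hKW_of_isotropy_of_finrank`), where
`Ψ = {x ∈ W : p^{r−1}·x ∈ Ker q̄}` is the PREIMAGE of `N := Ker q̄ ∩ W` under `[p^{r−1}] : W → W[p]`.  HONEST LABEL: HC_CM is proved only modulo the 2
remaining named inputs (hLiu418 24832, h413 24833) until rung 0 closes; this file is generic and discharges none of them.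

THE MATHEMATICS.  `k` a field; `φ : W → V` a homomorphism of affine `k`-group schemes.  Call `φ` **fppf-LIFTABLE** if every `T`-point `d` of `V` lifts to `W`
after an epimorphism of schemes `t : T′ → T` (`x ≫ φ = t ≫ d`); a flat surjective `φ` is liftable (pull back `d` along `φ`; Mathlib `Flat.epi_of_flat_of_surjective`),
and so is any restriction to the image of an fppf epimorphism of a bigger group (the consumer's `[p^{r−1}] : A ↠ A` cut down to the `w`-block).  THEN:
(§1) `Γ(φ) : Γ(V) → Γ(W)` is INJECTIVE (a function killed by `φ` is killed by the epimorphism `t` lifting the tautological point, and functions descend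
along epimorphisms, ★ `appTop_injective_of_epi`) — whence `φ` is flat and surjective (★ (KR), [Waterhouse1979] §14.1) and `rk Γ(W) = rk Γ(Ker φ) · rk Γ(V)`;
(§2) for a closed subgroup `ν : N ↪ V` and the PREIMAGE `ψ : Ψ ↪ W` (a monomorphism whose `T`-points are exactly the points of `W` mapping into `N`),
the restriction `φ′ : Ψ → N` (`φ′ ≫ ν = ψ ≫ φ`) is again liftable, `Ker φ′ ≅ Ker φ`, and therefore
**`rk Γ(Ψ) · rk Γ(V) = rk Γ(W) · rk Γ(N)`** ([Tate1997FiniteFlatGroupSchemes] §(3.7) «the order is multiplicative in exact sequences», applied to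
`0 → Ker φ → Ψ → N → 0` and `0 → Ker φ → W → V → 0`).

* §1 `comap_injective_of_liftable`, `exists_epi_lift_of_flat_of_surjective` (flat surjective ⟹ liftable), `finrank_alg_eq_ker_mul_of_liftable`;
* §2 `exists_restrict_of_preimage`, `isMonHom_restrict_of_preimage`, `liftable_restrict_of_preimage`, `finrank_alg_ker_restrict_eq`,
  HEAD **`finrank_alg_preimage_mul_eq_of_liftable`**.
* §3 (ED. 2, add-only) PRODUCERS OF LIFTABILITY: `liftable_of_cover` (lift through ANY flat surjective `Φ : X ↠ Y` dominating `φ` with a correction map),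
  **`liftable_of_torsionPins_mulN`** — `[m] : A[n·m] → A[n]` is liftable for the all-`T` torsion pins of an abelian scheme over a field
  (`[m] : A ↠ A` is fppf, ★ `AbelianSchemeOverMulNFiniteFlat`), and `finrank_alg_torsion_eq_ker_mul` (`rk Γ(A[n·m]) = rk Γ(Ker [m]|) · rk Γ(A[n])`).

## References
* [Waterhouse1979] W. C. Waterhouse, *Introduction to Affine Group Schemes*, GTM 66 (1979), §14.1 Theorem, §15.1.
* [Tate1997FiniteFlatGroupSchemes] J. Tate, *Finite flat group schemes* (1997), §(3.7)–(3.8) (pp. 144–146).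
* [MumfordAV1970] D. Mumford, *Abelian Varieties* (1970), §12 Thm. 1 (p. 112) (descent along finite flat quotients).
* [GortzWedhorn2020] U. Görtz, T. Wedhorn, *Algebraic Geometry I*, 2nd ed. (2020), Def. 4.45 (2) (p. 117); (14.20).
-/

set_option autoImplicit false

-- Mathlib's `Over`/`Scheme` APIs are stated across semireducible wrappers (as in the ★ `GroupSchemes/*` files).
set_option backward.isDefEq.respectTransparency false

noncomputable section

universe u

open CategoryTheory CategoryTheory.Limits AlgebraicGeometry MonoidalCategory CartesianMonoidalCategory
open scoped MonObj

namespace Literature.AlgebraicGeometry.GroupSchemes.AffineGroupScheme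

open Literature.AlgebraicGeometry.Motives Literature.AlgebraicGeometry.GroupSchemes.GroupSchemeKernel
open Literature.AlgebraicGeometry.AbelianSchemes.AbelianSchemeOver.DualPair (appTop_injective_of_epi)

/-! ## §1 Liftable homomorphisms: `Γ` is injective -/

section Liftable

variable {k : Type u} [Field k] {W V : SchemeOver k} (φ : W ⟶ V)

/-- **`Γ(φ)` IS INJECTIVE FOR AN fppf-LIFTABLE `φ`**: if every `T`-point `d` of `V` lifts to `W` after an epimorphism of schemes `t : T′ → T`
(`x ≫ φ = t ≫ d`), then `Γ(φ) : Γ(V) → Γ(W)` is injective — apply the hypothesis to the tautological point `𝟙_V`: a function `a` with `φ^* a = 0` has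
`t^* a = x^* φ^* a = 0`, and `t^*` is injective (★ `appTop_injective_of_epi`). [cite: Waterhouse1979, §14.1 Theorem] [cite: GortzWedhorn2020, Thm. 14.66] -/
theorem comap_injective_of_liftable
    (h : ∀ ⦃T : SchemeOver k⦄ (d : T ⟶ V), ∃ (T' : SchemeOver k) (t : T' ⟶ T) (_ : Epi t.left) (x : T' ⟶ W), x ≫ φ = t ≫ d) :
    Function.Injective (Alg.comap φ) := by
  obtain ⟨T', t, ht, x, hx⟩ := h (𝟙 V)
  rw [Category.comp_id] at hx
  intro a b hab
  apply appTop_injective_of_epi t.left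
  have key : ∀ c : Alg V, t.left.appTop c = x.left.appTop (Alg.comap φ c) := fun c => by
    rw [Alg.comap_apply, ← CommRingCat.comp_apply, ← Scheme.Hom.comp_appTop, ← Over.comp_left, hx]
  change t.left.appTop a = t.left.appTop b
  rw [key, key, hab]

/-- **A FLAT SURJECTIVE morphism is liftable**: pull the point `d : T → V` back along `φ` — `T′ := T ×_{d, V, φ} W → T` is flat and surjective, hence an
epimorphism of schemes (Mathlib `Flat.epi_of_flat_of_surjective`), and the second projection is the lift. [cite: GortzWedhorn2020, (14.20)]
[cite: Waterhouse1979, §14.1 Theorem] -/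
theorem exists_epi_lift_of_flat_of_surjective [Flat φ.left] [Surjective φ.left] ⦃T : SchemeOver k⦄ (d : T ⟶ V) :
    ∃ (T' : SchemeOver k) (t : T' ⟶ T) (_ : Epi t.left) (x : T' ⟶ W), x ≫ φ = t ≫ d := by
  let t₀ : pullback d.left φ.left ⟶ T.left := pullback.fst d.left φ.left
  let x₀ : pullback d.left φ.left ⟶ W.left := pullback.snd d.left φ.left
  have hcond : t₀ ≫ d.left = x₀ ≫ φ.left := pullback.condition
  haveI : Flat t₀ := MorphismProperty.pullback_fst _ _ inferInstance
  haveI : Surjective t₀ := MorphismProperty.pullback_fst _ _ inferInstance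
  haveI : Epi t₀ := Flat.epi_of_flat_of_surjective t₀
  have hx₀ : x₀ ≫ W.hom = t₀ ≫ T.hom := by
    have h1 : x₀ ≫ W.hom = (x₀ ≫ φ.left) ≫ V.hom := by rw [Category.assoc, Over.w]
    rw [h1, ← hcond, Category.assoc, Over.w d]
  refine ⟨Over.mk (t₀ ≫ T.hom), Over.homMk t₀ rfl, ‹Epi t₀›, Over.homMk x₀ hx₀, ?_⟩
  ext1
  exact hcond.symm

variable [GrpObj W] [IsAffine W.left] [GrpObj V] [IsAffine V.left] [IsMonHom φ]

/-- **`rk Γ(W) = rk Γ(Ker φ) · rk Γ(V)` for a liftable homomorphism of finite group schemes** (★ `finrank_alg_ker_mul_finrank` through §1).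
[cite: Waterhouse1979, §14.1 Theorem] [cite: Tate1997FiniteFlatGroupSchemes, (3.7)] -/
theorem finrank_alg_eq_ker_mul_of_liftable [Module.Finite k (Alg W)]
    (h : ∀ ⦃T : SchemeOver k⦄ (d : T ⟶ V), ∃ (T' : SchemeOver k) (t : T' ⟶ T) (_ : Epi t.left) (x : T' ⟶ W), x ≫ φ = t ≫ d) :
    Module.finrank k (Alg W) = Module.finrank k (Alg (ker φ)) * Module.finrank k (Alg V) :=
  (finrank_alg_ker_mul_finrank φ (comap_injective_of_liftable φ h)).symm

end Liftable

/-! ## §2 The preimage of a closed subgroup under a liftable homomorphism, and its rank -/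

section Preimage

variable {k : Type u} [Field k] {W V N Ψ : SchemeOver k} [GrpObj W] [IsAffine W.left] [GrpObj V] [IsAffine V.left]
  [GrpObj N] [IsAffine N.left] [GrpObj Ψ] [IsAffine Ψ.left]
  (φ : W ⟶ V) [IsMonHom φ] (ν : N ⟶ V) [IsMonHom ν] [Mono ν] (ψ : Ψ ⟶ W) [IsMonHom ψ] [Mono ψ]
  -- `Ψ` is THE PREIMAGE `φ⁻¹(N)`: a `T`-point of `W` factors through `ψ` iff its image factors through `ν`
  (hΨ : ∀ ⦃T : SchemeOver k⦄ (x : T ⟶ W), (∃ c : T ⟶ Ψ, c ≫ ψ = x) ↔ ∃ d : T ⟶ N, d ≫ ν = x ≫ φ)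

include hΨ in
omit [GrpObj W] [IsAffine W.left] [GrpObj V] [IsAffine V.left] [GrpObj N] [IsAffine N.left] [GrpObj Ψ] [IsAffine Ψ.left] [IsMonHom φ]
  [IsMonHom ν] [Mono ν] [IsMonHom ψ] [Mono ψ] in
/-- The restriction `φ′ : Ψ → N` of `φ` to the preimage EXISTS (`φ′ ≫ ν = ψ ≫ φ`): the tautological point `ψ` of `W` maps into `N`.
[cite: GortzWedhorn2020, Def. 4.45 (2) (p. 117)] -/
theorem exists_restrict_of_preimage : ∃ φ' : Ψ ⟶ N, φ' ≫ ν = ψ ≫ φ :=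
  (hΨ ψ).mp ⟨𝟙 Ψ, Category.id_comp ψ⟩

variable (φ' : Ψ ⟶ N) (hφ' : φ' ≫ ν = ψ ≫ φ)

include hφ' in
omit [IsAffine W.left] [IsAffine V.left] [IsAffine N.left] [IsAffine Ψ.left] [Mono ψ] in
/-- The restriction `φ′` is a homomorphism (`φ′ ≫ ν = ψ ≫ φ` is one and `ν` is a monomorphism, ★ `isMonHom_of_comp_mono`).
[cite: GortzWedhorn2020, Def. 4.45 (2) (p. 117)] -/
theorem isMonHom_restrict_of_preimage : IsMonHom φ' := by
  haveI : IsMonHom (φ' ≫ ν) := by rw [hφ']; infer_instance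
  exact isMonHom_of_comp_mono φ' ν

include hΨ hφ' in
omit [GrpObj W] [IsAffine W.left] [GrpObj V] [IsAffine V.left] [GrpObj N] [IsAffine N.left] [GrpObj Ψ] [IsAffine Ψ.left] [IsMonHom φ]
  [IsMonHom ν] [IsMonHom ψ] [Mono ψ] in
/-- **The restriction of a liftable `φ` to the preimage is liftable**: lift `d ≫ ν` along `φ` to `x` on an epimorphic `T′`; `x` maps into `N`, so it is a
point `c` of `Ψ`, and `c ≫ φ′ = t ≫ d` (compare after the monomorphism `ν`). [cite: GortzWedhorn2020, (14.20)] [cite: Waterhouse1979, §15.1] -/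
theorem liftable_restrict_of_preimage
    (h : ∀ ⦃T : SchemeOver k⦄ (d : T ⟶ V), ∃ (T' : SchemeOver k) (t : T' ⟶ T) (_ : Epi t.left) (x : T' ⟶ W), x ≫ φ = t ≫ d)
    ⦃T : SchemeOver k⦄ (d : T ⟶ N) :
    ∃ (T' : SchemeOver k) (t : T' ⟶ T) (_ : Epi t.left) (c : T' ⟶ Ψ), c ≫ φ' = t ≫ d := by
  obtain ⟨T', t, ht, x, hx⟩ := h (d ≫ ν)
  obtain ⟨c, hc⟩ := (hΨ x).mpr ⟨t ≫ d, by rw [Category.assoc, hx]⟩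
  refine ⟨T', t, ht, c, ?_⟩
  rw [← cancel_mono ν, Category.assoc, hφ', ← Category.assoc, hc, hx, Category.assoc]

include hΨ hφ' in
omit [GrpObj W] [IsAffine W.left] [IsAffine V.left] [IsAffine N.left] [GrpObj Ψ] [IsAffine Ψ.left] [IsMonHom φ] [IsMonHom ψ] in
/-- **`Ker φ′ ≅ Ker φ`**: both have the `T`-points «points of `W` killed by `φ`» (those lie in `Ψ`, being mapped to `1 ∈ N`).
[cite: GortzWedhorn2020, Def. 4.45 (2) (p. 117)] -/
theorem nonempty_ker_restrict_iso_ker : Nonempty (ker φ' ≅ ker φ) := by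
  haveI := mono_kerι φ
  haveI := mono_kerι φ'
  -- `Ker φ′ → Ker φ`: the point `kerι φ′ ≫ ψ` of `W` is killed by `φ`
  have h₁ : (kerι φ' ≫ ψ) ≫ φ = 1 := by
    rw [Category.assoc, ← hφ', ← Category.assoc, kerι_comp, MonObj.one_comp]
  -- `Ker φ → Ker φ′`: the point `kerι φ` of `W` maps to `1 ∈ N`, hence lies in `Ψ`, and its image under `φ′` is `1`
  obtain ⟨c, hc⟩ := (hΨ (kerι φ)).mpr ⟨1, by rw [kerι_comp, MonObj.one_comp]⟩
  have h₂ : c ≫ φ' = 1 := by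
    rw [← cancel_mono ν, Category.assoc, hφ', ← Category.assoc, hc, kerι_comp, MonObj.one_comp]
  refine ⟨⟨kerLift (kerι φ' ≫ ψ) h₁, kerLift c h₂, ?_, ?_⟩⟩
  · apply ker_hom_ext
    rw [← cancel_mono ψ, Category.id_comp, Category.assoc, Category.assoc]
    have e2 : kerLift c h₂ ≫ kerι φ' ≫ ψ = kerι φ := by rw [← Category.assoc, kerLift_ι, hc]
    rw [e2, kerLift_ι]
  · apply ker_hom_ext
    rw [Category.id_comp, Category.assoc, kerLift_ι, ← Category.assoc, kerLift_ι, hc]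

include hΨ hφ' in
omit [GrpObj W] [IsAffine W.left] [IsAffine V.left] [IsAffine N.left] [GrpObj Ψ] [IsAffine Ψ.left] [IsMonHom φ] [IsMonHom ψ] in
/-- `rk Γ(Ker φ′) = rk Γ(Ker φ)`. [cite: Tate1997FiniteFlatGroupSchemes, (3.7)] -/
theorem finrank_alg_ker_restrict_eq : Module.finrank k (Alg (ker φ')) = Module.finrank k (Alg (ker φ)) := by
  obtain ⟨e⟩ := nonempty_ker_restrict_iso_ker φ ν ψ hΨ φ' hφ'
  refine LinearEquiv.finrank_eq (AlgEquiv.ofAlgHom (Alg.comap e.inv) (Alg.comap e.hom) ?_ ?_).toLinearEquiv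
  · rw [← Alg.comap_comp, Iso.inv_hom_id, Alg.comap_id]
  · rw [← Alg.comap_comp, Iso.hom_inv_id, Alg.comap_id]

include hΨ hφ' in
/-- **THE RANK OF A PREIMAGE — `rk Γ(Ψ) · rk Γ(V) = rk Γ(W) · rk Γ(N)`** for a liftable homomorphism `φ : W → V` of finite group schemes over a field, a
closed subgroup `ν : N ↪ V` and its preimage `ψ : Ψ = φ⁻¹(N) ↪ W` with the restriction `φ′ : Ψ → N`: the two kernel–rank laws (★ (KR)) for `φ` and for
`φ′` (liftable by `liftable_restrict_of_preimage`) with `Ker φ′ ≅ Ker φ`.  The (I-rk) reading: `W` the `w`-block of `A[q]`, `φ = [p^{r−1}] : W ↠ W[p]`,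
`N = Ker q̄ ∩ W`, `Ψ = {x : p^{r−1}x ∈ Ker q̄}`. [cite: Tate1997FiniteFlatGroupSchemes, §(3.7)–(3.8) (pp. 144–146)] [cite: Waterhouse1979, §14.1 Theorem] -/
theorem finrank_alg_preimage_mul_eq_of_liftable [Module.Finite k (Alg W)] [Module.Finite k (Alg Ψ)]
    (h : ∀ ⦃T : SchemeOver k⦄ (d : T ⟶ V), ∃ (T' : SchemeOver k) (t : T' ⟶ T) (_ : Epi t.left) (x : T' ⟶ W), x ≫ φ = t ≫ d) :
    Module.finrank k (Alg Ψ) * Module.finrank k (Alg V) = Module.finrank k (Alg W) * Module.finrank k (Alg N) := by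
  haveI := isMonHom_restrict_of_preimage φ ν ψ φ' hφ'
  rw [finrank_alg_eq_ker_mul_of_liftable φ h,
    finrank_alg_eq_ker_mul_of_liftable φ' (liftable_restrict_of_preimage φ ν ψ hΨ φ' hφ' h),
    finrank_alg_ker_restrict_eq φ ν ψ hΨ φ' hφ']
  ring

end Preimage

/-! ## §3 (ED. 2) Producers of liftability: flat surjective covers; `[m] : A[n·m] → A[n]` -/

section Cover

variable {k : Type u} [Field k] {W V X Y : SchemeOver k} (φ : W ⟶ V)

/-- **LIFTABILITY THROUGH A COVER**: if a flat surjective `Φ : X ↠ Y` dominates `φ` through `j_V : V → Y` in the sense that every `T`-point `y` of `X`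
whose image `y ≫ Φ` is (the image of) a point `d` of `V` can be CORRECTED to a point `x` of `W` with `x ≫ φ = d`, then `φ` is liftable (pull `d ≫ j_V`
back along `Φ`, ★ `exists_epi_lift_of_flat_of_surjective`, then correct).  The correction is the consumer's projection (e.g. onto a block of `A[q]` by
a CRT idempotent). [cite: GortzWedhorn2020, (14.20)] [cite: Waterhouse1979, §15.1] -/
theorem liftable_of_cover (Φ : X ⟶ Y) [Flat Φ.left] [Surjective Φ.left] (jV : V ⟶ Y)
    (hproj : ∀ ⦃T : SchemeOver k⦄ (y : T ⟶ X) (d : T ⟶ V), y ≫ Φ = d ≫ jV → ∃ x : T ⟶ W, x ≫ φ = d)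
    ⦃T : SchemeOver k⦄ (d : T ⟶ V) :
    ∃ (T' : SchemeOver k) (t : T' ⟶ T) (_ : Epi t.left) (x : T' ⟶ W), x ≫ φ = t ≫ d := by
  obtain ⟨T', t, ht, y, hy⟩ := exists_epi_lift_of_flat_of_surjective Φ (d ≫ jV)
  obtain ⟨x, hx⟩ := hproj y (t ≫ d) (by rw [hy, Category.assoc])
  exact ⟨T', t, ht, x, hx⟩

end Cover

section TorsionPins

open Literature.AlgebraicGeometry.AbelianSchemes Literature.AlgebraicGeometry.AbelianSchemes.AbelianSchemeOver

variable {k : Type u} [Field k] (A : AbelianSchemeOver (Spec (CommRingCat.of k))) (n m : ℕ)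
  {G V : SchemeOver k} (jG : G ⟶ A.X) (jV : V ⟶ A.X) [Mono jV]
  (hG : ∀ ⦃T : SchemeOver k⦄ (t : T ⟶ A.X), (∃ s : T ⟶ G, s ≫ jG = t) ↔ t ≫ A.mulN (n * m) = 1)
  (hV : ∀ ⦃T : SchemeOver k⦄ (t : T ⟶ A.X), (∃ s : T ⟶ V, s ≫ jV = t) ↔ t ≫ A.mulN n = 1)
  (φ : G ⟶ V) (hφ : φ ≫ jV = jG ≫ A.mulN m)

include hG hV hφ in
/-- **`[m] : A[n·m] → A[n]` IS LIFTABLE** for the all-`T` torsion pins `j_G : G = A[n·m] ↪ A`, `j_V : V = A[n] ↪ A` (`j_V` mono) of an abelian scheme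
over a field and the induced `φ` (`φ ≫ j_V = j_G ≫ [m]`), `m ≠ 0`: `[m] : A ↠ A` is flat and surjective (★ `AbelianSchemeOverMulNFiniteFlat`), and an
`m`-th root `y` of an `n`-torsion point is `n·m`-torsion, i.e. a point of `G` — no correction needed. [cite: MumfordAV1970, §6 Application 2 (p. 64); §12 Thm. 1 (p. 112)]
[cite: GortzWedhorn2020, (14.20)] -/
theorem liftable_of_torsionPins_mulN (hm : m ≠ 0) ⦃T : SchemeOver k⦄ (d : T ⟶ V) :
    ∃ (T' : SchemeOver k) (t : T' ⟶ T) (_ : Epi t.left) (x : T' ⟶ G), x ≫ φ = t ≫ d := by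
  haveI : Flat (A.mulN m).left := by rw [mulN_def]; exact A.flat_pow_id_left_of_ne_zero hm
  haveI : Surjective (A.mulN m).left := by rw [mulN_def]; exact A.surjective_pow_id_left_of_ne_zero hm
  refine liftable_of_cover φ (A.mulN m) jV (fun T y d hy => ?_) d
  -- `y` is `n·m`-torsion: `y ≫ [n·m] = (y ≫ [m]) ≫ [n] = d ≫ j_V ≫ [n] = 1`
  have hVn : jV ≫ A.mulN n = 1 := (hV jV).mp ⟨𝟙 V, Category.id_comp jV⟩
  have hy' : y ≫ A.mulN (n * m) = 1 := by
    rw [mul_comm, mulN_def, pow_mul, ← mulN_def, ← Category.comp_id (A.mulN m), ← MonObj.comp_pow, ← mulN_def, ← Category.assoc, hy,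
      Category.assoc, hVn, MonObj.comp_one]
  obtain ⟨s, hs⟩ := (hG y).mpr hy'
  refine ⟨s, ?_⟩
  rw [← cancel_mono jV, Category.assoc, hφ, ← Category.assoc, hs, hy]

include hG hV hφ in
/-- **`rk Γ(A[n·m]) = rk Γ(Ker φ) · rk Γ(A[n])`** for the torsion pins (`G`, `V` finite affine group schemes, `φ` a homomorphism), `m ≠ 0` — the kernel–rank law
for the liftable `φ = [m]|` (§1). [cite: Tate1997FiniteFlatGroupSchemes, (3.7)] [cite: Waterhouse1979, §14.1 Theorem] -/
theorem finrank_alg_torsion_eq_ker_mul [GrpObj G] [IsAffine G.left] [GrpObj V] [IsAffine V.left] [IsMonHom φ] [Module.Finite k (Alg G)]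
    (hm : m ≠ 0) : Module.finrank k (Alg G) = Module.finrank k (Alg (ker φ)) * Module.finrank k (Alg V) :=
  finrank_alg_eq_ker_mul_of_liftable φ (liftable_of_torsionPins_mulN A n m jG jV hG hV φ hφ hm)

end TorsionPins

end Literature.AlgebraicGeometry.GroupSchemes.AffineGroupScheme

end
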